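import Summits.Ventures.QEC.CircuitDistance.WitnessesQ4
import Summits.Ventures.QEC.CircuitDistance.SchedMono
import Summits.Ventures.QEC.CircuitDistance.ClaimsQ4
import HarnessLib

/-!
# Order `sched345` of `[[144,12,12]]`: the weight-11 witness at EVERY `N_c ≥ 1` and the decided form of `¬ CDX_Q4_345`
# (venture QEC, experiment cell CDX, Q4 lane — UPPER side only; nothing here asserts the value of `d_circ`)

Provenance: drafted by qec-cdx-idea-2 g2 (2026-08-29, addendum 2 to `WitnessesQ4`), typed by qec-cdx-type-2 as a separate file
(`WitnessesQ4.lean` had landed), statement audit qec-cdx-crit-1.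

By `SchedMono.hasAtₛ_of_one` (last-cycle placement, valid for every CNOT order) the kernel-checked one-cycle set
`sched345_hasLogicalFault_eleven_Z` of `WitnessesQ4.lean` yields an undetectable logical set of `≤ 11` operations in the `Nc`-cycle
circuit for every `Nc ≥ 1` — exactly the `hwit` hypothesis of the pre-registered decided form `CDX_Q4_345_neg_decided`
(`ClaimsQ4.lean`). Hence the negative branch of CDX-Q4 reads: `¬ CDX_Q4_345 → ∀ Nc ≥ 1, circuitDistanceₛ sched345 bb144SM Nc = 11`,
with `¬ CDX_Q4_345` its ONLY remaining hypothesis. Hygiene of record (R151 (4)): UPPER side certified («explicit weight-11 sets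
exhibited», now at every `N_c ≥ 1`, KERNEL, std); the `≤ 10` side is the pre-registered question `CDX_Q4_345`, undecided here
(SOLVER/ENUMERATION tier ×2 in the cell's own model family). Variant numbering ours (orders936.json, criterion O1; RIDER L).
-/

namespace Summit.Ventures.QEC.CircuitDistance

/-- **`∀ Nc ≥ 1, HasLogicalFaultOfWeightAtMostAtₛ sched345 bb144SM Nc 11`** — the `hwit` hypothesis of `CDX_Q4_345_neg_decided`
(the eleven operations of `sched345_setZ`, performed in the last cycle). -/
theorem sched345_hasLogicalFault_eleven_all : ∀ Nc : ℕ, 1 ≤ Nc → HasLogicalFaultOfWeightAtMostAtₛ sched345 bb144SM Nc 11 :=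
  hasAtₛ_of_one sched345 bb144SM 11 sched345_hasLogicalFault_eleven_Z

/-- Hence `circuitDistanceₛ sched345 bb144SM Nc ≤ 11` for every `Nc ≥ 1`. -/
theorem sched345_circuitDistanceₛ_le (Nc : ℕ) (hNc : 1 ≤ Nc) : circuitDistanceₛ sched345 bb144SM Nc ≤ 11 :=
  circuitDistanceₛ_le_of_hasAt sched345 bb144SM Nc 11 (sched345_hasLogicalFault_eleven_all Nc hNc)

/-- `HasLogicalFaultOfWeightAtMostₛ sched345 bb144SM 11` (the `∃ Nc` shape of the pre-registered question, one weight up). -/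
theorem sched345_has_eleven : HasLogicalFaultOfWeightAtMostₛ sched345 bb144SM 11 := ⟨1, sched345_hasLogicalFault_eleven_Z⟩

/-- **DECIDED FORM, negative branch, witness half discharged**: if the pre-registered `CDX_Q4_345` is refuted (no weight-`≤ 10`
set in any number of cycles), then `d_circ(sched345) = 11` for every `Nc ≥ 1` — the remaining hypothesis is `¬ CDX_Q4_345` alone. -/
theorem circuitDistanceₛ_sched345_eq_eleven_of_not_Q4 (hneg : ¬ CDX_Q4_345) :
    ∀ Nc : ℕ, 1 ≤ Nc → circuitDistanceₛ sched345 bb144SM Nc = 11 :=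
  CDX_Q4_345_neg_decided hneg sched345_hasLogicalFault_eleven_all

end Summit.Ventures.QEC.CircuitDistance
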